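import Summits.QuantumFields.GaugeBoot.Certificates.SparseReducedWindowE
import HarnessLib

/-!
# Sparse certificate replay, support: APPENDING blocks to a reduced family table (class-LIMIT groundwork)

Cell `ym-instrument` (HOME `run/shared/lean/pub/ym-instrument/`), crew (a), seat `ym-instrument-boot-lean-1` (gen 3); groundwork for the
planner proposal P-A5 «class-LIMIT kernel replay» (desk `LIMIT-BIND-SCOPE.md`): a class-LIMIT problem file of the kz-L2-rp-4D family is «the
Class-A file + 5 small LIMIT blocks (+ 9 inequality rows)», so its entry table is `EB ++ EBlim` with the family table `EB` of record
(`Certificates/KZL2rpD4TabA`, 70 blocks, kernel-checked once) and a 5-block appendix. This module proves, generically, that the three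
FAMILY-LEVEL checks consumed by the window route — `dimCheck`, `rowLenCheck`, `sortedCheck` — of an appended table follow from those of the
two parts (so the appendix costs five tiny `decide`s, not a re-walk of `EB`), and that `ent`/`redE` of the appended table are the parts'
(`ent_append_left/right`, `redE_append_left/right`: the first `EB.length` reduced blocks are literally the blocks of record).
Pure list bookkeeping; [folklore]; nothing here is specific to lattice gauge theory.

HONEST FRAMING (cells `pub-gaugeboot` / `ym-instrument`): certified bounds on lattice expectations at stated coupling, gauge group,
dimension and torus size; NOT a mass gap, NOT a continuum limit, NOT a string tension; NOT Yang–Mills-summit-bearing. This module certifies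
nothing by itself.
-/

namespace Summit.QuantumFields.GaugeBoot.Certificates.Sparse

open Matrix Finset Literature.Computation.Certificates

section Append

variable (EB EB₂ : List (List (List (List (ℕ × ℤ)))))

/-- Block access in an appended table, left part. [folklore] -/
theorem getD_append_left {k : ℕ} (hk : k < EB.length) : (EB ++ EB₂).getD k [] = EB.getD k [] := by
  rw [List.getD_eq_getElem?_getD, List.getD_eq_getElem?_getD, List.getElem?_append_left hk]

/-- Block access in an appended table, right part. [folklore] -/
theorem getD_append_right (k : ℕ) : (EB ++ EB₂).getD (EB.length + k) [] = EB₂.getD k [] := by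
  rw [List.getD_eq_getElem?_getD, List.getD_eq_getElem?_getD, List.getElem?_append_right (Nat.le_add_right _ _),
    Nat.add_sub_cancel_left]

/-- `ent` of an appended table, left part. [folklore] -/
theorem ent_append_left {k : ℕ} (hk : k < EB.length) (i j : ℕ) : ent (EB ++ EB₂) k i j = ent EB k i j := by
  simp only [ent, entU, getD_append_left EB EB₂ hk]

/-- `ent` of an appended table, right part. [folklore] -/
theorem ent_append_right (k i j : ℕ) : ent (EB ++ EB₂) (EB.length + k) i j = ent EB₂ k i j := by
  simp only [ent, entU, getD_append_right EB EB₂ k]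

/-- `redE` of an appended table, left part: the first blocks are the blocks of record. [folklore] -/
theorem redE_append_left {k : ℕ} (hk : k < EB.length) (d nv : ℕ) (y : Fin nv → ℝ) :
    redE (EB ++ EB₂) k d nv y = redE EB k d nv y := by
  ext i j; simp only [redE_apply, ent_append_left EB EB₂ hk]

/-- `redE` of an appended table, right part. [folklore] -/
theorem redE_append_right (k d nv : ℕ) (y : Fin nv → ℝ) :
    redE (EB ++ EB₂) (EB.length + k) d nv y = redE EB₂ k d nv y := by
  ext i j; simp only [redE_apply, ent_append_right EB EB₂ k]

variable {EB EB₂}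

/-- **`dimCheck` of an appended table** from the checks of the parts. [folklore] -/
theorem dimCheck_append {dimL dimL₂ : List ℕ} {m nb nb₂ : ℕ} (hlen : EB.length = nb) (hdl : dimL.length = nb)
    (h₁ : dimCheck EB dimL m nb = true) (h₂ : dimCheck EB₂ dimL₂ m nb₂ = true) :
    dimCheck (EB ++ EB₂) (dimL ++ dimL₂) m (nb + nb₂) = true := by
  rw [dimCheck, natAll_iff] at h₁ h₂ ⊢
  intro k hk
  by_cases hk1 : k < nb
  · have hkE : k < EB.length := hlen ▸ hk1
    have hd : (dimL ++ dimL₂).getD k 0 = dimL.getD k 0 := by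
      rw [List.getD_eq_getElem?_getD, List.getD_eq_getElem?_getD, List.getElem?_append_left (hdl ▸ hk1)]
    have h := h₁ k hk1
    rw [natAll_iff] at h ⊢
    intro i hi
    have h' := h i hi
    rw [natAll_iff] at h' ⊢
    intro j hj
    rw [hd, ent_append_left EB EB₂ hkE]
    exact h' j hj
  · obtain ⟨k', rfl⟩ : ∃ k', k = nb + k' := ⟨k - nb, by omega⟩
    have hk' : k' < nb₂ := by omega
    have hd : (dimL ++ dimL₂).getD (nb + k') 0 = dimL₂.getD k' 0 := by
      rw [List.getD_eq_getElem?_getD, List.getD_eq_getElem?_getD, ← hdl, List.getElem?_append_right (Nat.le_add_right _ _),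
        Nat.add_sub_cancel_left]
    have h := h₂ k' hk'
    rw [natAll_iff] at h ⊢
    intro i hi
    have h' := h i hi
    rw [natAll_iff] at h' ⊢
    intro j hj
    rw [hd, ← hlen, ent_append_right EB EB₂ k']
    exact h' j hj

/-- **`rowLenCheck` of an appended table** from the checks of the parts. [folklore] -/
theorem rowLenCheck_append {m nb nb₂ : ℕ} (hlen : EB.length = nb)
    (h₁ : rowLenCheck EB m nb = true) (h₂ : rowLenCheck EB₂ m nb₂ = true) :
    rowLenCheck (EB ++ EB₂) m (nb + nb₂) = true := by
  rw [rowLenCheck, natAll_iff] at h₁ h₂ ⊢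
  intro k hk
  by_cases hk1 : k < nb
  · rw [getD_append_left EB EB₂ (hlen ▸ hk1)]; exact h₁ k hk1
  · obtain ⟨k', rfl⟩ : ∃ k', k = nb + k' := ⟨k - nb, by omega⟩
    rw [← hlen, getD_append_right EB EB₂ k']; exact h₂ k' (by omega)

/-- **`sortedCheck` of an appended table** from the checks of the parts. [folklore] -/
theorem sortedCheck_append (h₁ : sortedCheck EB = true) (h₂ : sortedCheck EB₂ = true) : sortedCheck (EB ++ EB₂) = true := by
  rw [sortedCheck] at h₁ h₂ ⊢
  rw [List.all_append, h₁, h₂, Bool.and_self]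

end Append

end Summit.QuantumFields.GaugeBoot.Certificates.Sparse
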